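import Mathlib
import Summits.NavierStokesRegularity.NavierStokesRegularity.Theorems.FilamentSkeletonRssSkeletonJ1LSymmetricPair
import Summits.NavierStokesRegularity.NavierStokesRegularity.Theorems.FilamentSkeletonRssSkeletonJ1RFrameDefs

/-!
# `SkeletonJ1L` (stmt-NavierStokesRegularity-23296) from ONE EXACT STREAMLINE of the TRUE field in the `R_π`-symmetric class
# (+ the clause-13 child) — the `∀ u v` defining-equation quantifier of the crux eliminated

Capstone of this hand's reductions (p837172 curve core → p837299 single datum → p837386 symmetry transport → p837719/p837806 symmetric pair, minimal core).
The crux quantifies its field through defining equations (`∀ u v, u = Σ∫…, v = u_X + ½y − αe₃×y → …`); any such `v` IS the explicit field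
`Theorems.SkeletonJ1RFrame.trueField Γ γ α X` of the J1R frame vocabulary (rigid unit cores — the same kernel, `trueField_of_defining`).  Hence:
★ `skeletonJ1L_of_halfTurnStreamline` — `Theses.FilamentSkeletonRss.SkeletonJ1L` BY NAME from `Theses.FilamentSkeletonRss.Clause13NearStraightL` and a
family (box constants; for all small `Rb`, all large `Γ`) of ONE `C²` unit-speed curve `X₀` — presented as the pair `X = (X₀, R_π X₀)` — with curvature
`≤ K/√Γ`, tangent oscillation `≤ Rb`, waist `‖X₀(cc)‖ ≤ Rw√Γ`, tilt, separation from its half-turn image, whose TRUE-FIELD slip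
`w₀ = ⟪trueField(X)(X₀ ·), X₀′⟫` (pair `γ ≡ 125π/108`, `α = 875/432`) is differentiable with a unique supercritical zero at `cc` and `|w₀′| ≤ Λ`, and
which is an EXACT STREAMLINE of the true field on the ball `‖X₀‖ ≤ Rb√(Γ log Γ)`.  No `u`, `v`, `Aa`, `KA`, `cg`, second filament, chord–arc, escape,
properness or integrability clause is left to the constructor.
HONEST FRAMING: bookkeeping about a HYPOTHETICAL filament skeleton on the NEGATIVE side of a MODEL route; the existence of such a streamline (the heart
⟨23320⟩ at one datum) and the clause-13 child ⟨23321⟩ remain OPEN; nothing bears on Navier–Stokes regularity or blow-up.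
`--supports stmt-NavierStokesRegularity-23296`. [folklore]
-/

set_option linter.dupNamespace false

noncomputable section

namespace Summit.NavierStokesRegularity.NavierStokesRegularity.Theorems.SkeletonJ1LSymmetricStreamline

open Filter MeasureTheory
open scoped InnerProductSpace BigOperators
open Literature.Analysis.FluidPDE
open Summit.NavierStokesRegularity.NavierStokesRegularity.Theorems.SkeletonJ1RFrame (trueField bsField)
open Summit.NavierStokesRegularity.NavierStokesRegularity.Theorems.SkeletonJ1LSymmetricPair (skeletonJ1L_of_halfTurnSymmetricCoreMin)

/-- **Any field satisfying the crux's defining equations (unit cores) is the explicit `trueField`.** [folklore] -/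
theorem trueField_of_defining {N : ℕ} {Γ α : ℝ} {γ : Fin N → ℝ} {X : Fin N → ℝ → EuclideanSpace ℝ (Fin 3)}
    {u : (Fin N → ℝ → EuclideanSpace ℝ (Fin 3)) → EuclideanSpace ℝ (Fin 3) → EuclideanSpace ℝ (Fin 3)}
    {v : EuclideanSpace ℝ (Fin 3) → EuclideanSpace ℝ (Fin 3)}
    (hu : ∀ Z y, u Z y = ∑ k, (Γ*γ k/(4*Real.pi))•∫ σ:ℝ, ((‖y-Z k σ‖^2+Real.exp (-(1+Real.eulerMascheroniConstant-Real.log 2)))^(3/2:ℝ))⁻¹•cross (deriv (Z k) σ) (y-Z k σ))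
    (hv : ∀ y, v y = u X y+(1/2:ℝ)•y-α•cross (EuclideanSpace.single 2 1) y) (y : EuclideanSpace ℝ (Fin 3)) :
    v y = trueField Γ γ α X y := by
  rw [hv y, hu X y, trueField, bsField]
  simp only [mul_one]

/-- ★ **`SkeletonJ1L` BY NAME from ONE exact streamline of the true field in the `R_π` class and the clause-13 child.** [folklore] -/
theorem skeletonJ1L_of_halfTurnStreamline
    (hfam : ∃ (δ ρ K Λ Rw θ₀ Rb₁ : ℝ), 0 < δ ∧ 0 < ρ ∧ 0 < Rw ∧ 0 < θ₀ ∧ 0 < Rb₁ ∧ Rb₁ ≤ 1 / 2 ∧ 2 * K * ρ ≤ 1 ∧ 1 ≤ Λ ∧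
      (θ₀ ≤ |(875/432 : ℝ)| ∧ |(875/432 : ℝ)| ≤ θ₀⁻¹ ∧ θ₀ ≤ |(125 * Real.pi / 108 : ℝ)| ∧ |(125 * Real.pi / 108 : ℝ)| ≤ θ₀⁻¹) ∧
      ∀ Rb : ℝ, 0 < Rb → Rb ≤ Rb₁ → ∃ Γ₂ : ℝ, ∀ Γ : ℝ, Γ₂ ≤ Γ →
        ∃ (X : Fin 2 → ℝ → EuclideanSpace ℝ (Fin 3)) (w₀ : ℝ → ℝ) (cc : ℝ),
          (∀ σ, X 1 σ 0 = -X 0 σ 0 ∧ X 1 σ 1 = -X 0 σ 1 ∧ X 1 σ 2 = X 0 σ 2) ∧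
          ContDiff ℝ 2 (X 0) ∧ (∀ τ, ‖deriv (X 0) τ‖ = 1) ∧ (∀ τ, ‖iteratedDeriv 2 (X 0) τ‖*√Γ≤K) ∧
          (∀ τ σ, ‖deriv (X 0) τ - deriv (X 0) σ‖ ≤ Rb) ∧
          (∀ τ σ, ρ*√Γ ≤ ‖X 0 τ - X 1 σ‖) ∧ ‖X 0 cc‖≤Rw*√Γ ∧ |⟪deriv (X 0) cc, EuclideanSpace.single 2 1⟫_ℝ|≤1-θ₀ ∧
          (∀ τ, w₀ τ = ⟪trueField Γ (fun _ : Fin 2 => 125 * Real.pi / 108) (875/432 : ℝ) X (X 0 τ), deriv (X 0) τ⟫_ℝ) ∧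
          Differentiable ℝ w₀ ∧ (w₀ cc = 0 ∧ (∀ τ, w₀ τ = 0 → τ = cc) ∧ 3/2+δ≤deriv w₀ cc ∧ deriv w₀ cc≤Λ) ∧ (∀ τ, |deriv w₀ τ| ≤ Λ) ∧
          (∀ τ, ‖X 0 τ‖≤Rb*√(Γ*Real.log Γ) →
            trueField Γ (fun _ : Fin 2 => 125 * Real.pi / 108) (875/432 : ℝ) X (X 0 τ) = w₀ τ•deriv (X 0) τ))
    (h3 : Summit.NavierStokesRegularity.NavierStokesRegularity.Theses.FilamentSkeletonRss.Clause13NearStraightL) :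
    Summit.NavierStokesRegularity.NavierStokesRegularity.Theses.FilamentSkeletonRss.SkeletonJ1L := by
  obtain ⟨δ, ρ, K, Λ, Rw, θ₀, Rb₁, hδ, hρ, hRw, hθ₀, hRb₁, hRbh, hKρ, hΛ, hbox, hfam⟩ := hfam
  refine skeletonJ1L_of_halfTurnSymmetricCoreMin ⟨δ, ρ, K, Λ, Rw, θ₀, Rb₁, hδ, hρ, hRw, hθ₀, hRb₁, hRbh, hKρ, hΛ, hbox, ?_⟩ h3
  intro Rb hRb hRb1
  obtain ⟨Γ₂, hΓ⟩ := hfam Rb hRb hRb1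
  refine ⟨Γ₂, fun Γ hΓ2 => ?_⟩
  obtain ⟨X, w₀, cc, hsym, hC, hunit, hcurv, hosc, hsep, hwaist, htilt, hslip, hwd, hzero, hw', htan⟩ := hΓ Γ hΓ2
  refine ⟨X, w₀, cc, hsym, hC, hwd, hunit, hcurv, hsep, hwaist, htilt, hzero, hosc, hw', ?_⟩
  intro u v hu hv
  have hvt : ∀ y, v y = trueField Γ (fun _ : Fin 2 => 125 * Real.pi / 108) (875/432 : ℝ) X y :=
    fun y => trueField_of_defining hu hv y
  exact ⟨fun τ => by rw [hvt]; exact hslip τ, fun τ h => by rw [hvt]; exact htan τ h⟩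

/-! ## §2 (appended, same hand) Separation from the half-turn image is a ONE-COORDINATE floor -/

/-- **In the `R_π` class the separation of the two strands is a floor on ONE coordinate of ONE strand**: if `x₀(τ) := (X₀ τ)₀ ≥ r ≥ 0` for all `τ`,
then `‖X₀ τ − R_π X₀ σ‖ ≥ (X₀ τ)₀ + (X₀ σ)₀ ≥ 2r` (the half-turn negates the first two coordinates).  Mechanism note: at the landed datum the
first coordinate of the strand is `(2/25)√Γ` identically and the leading-order bending lies in the `(e₂, e₃)`-plane, so the floor is the natural
design condition. [folklore] -/
theorem sep_of_coordFloor {X : Fin 2 → ℝ → EuclideanSpace ℝ (Fin 3)} {r : ℝ}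
    (hsym : ∀ σ, X 1 σ 0 = -X 0 σ 0 ∧ X 1 σ 1 = -X 0 σ 1 ∧ X 1 σ 2 = X 0 σ 2) (hr : 0 ≤ r) (hfloor : ∀ τ, r ≤ X 0 τ 0)
    (τ σ : ℝ) : 2 * r ≤ ‖X 0 τ - X 1 σ‖ := by
  -- `|v₀| ≤ ‖v‖` in `ℝ³` (also `…AveragedConeLiouville.NUPositivity.abs_apply_zero_le_norm`; re-derived to keep the import cone small)
  have hcoord : ∀ v : EuclideanSpace ℝ (Fin 3), |v 0| ≤ ‖v‖ := fun v => by
    have h : ‖v‖ ^ 2 = v 0 ^ 2 + v 1 ^ 2 + v 2 ^ 2 := by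
      rw [EuclideanSpace.norm_sq_eq]; simp [Fin.sum_univ_three, Real.norm_eq_abs, sq_abs]
    have h2 : v 0 ^ 2 ≤ ‖v‖ ^ 2 := by rw [h]; nlinarith [sq_nonneg (v 1), sq_nonneg (v 2)]
    exact abs_le.mpr (abs_le_of_sq_le_sq' h2 (norm_nonneg v))
  have h := hcoord (X 0 τ - X 1 σ)
  rw [PiLp.sub_apply, (hsym σ).1, sub_neg_eq_add] at h
  have hp : 0 ≤ X 0 τ 0 + X 0 σ 0 := by linarith [hfloor τ, hfloor σ]
  rw [abs_of_nonneg hp] at h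
  linarith [hfloor τ, hfloor σ]

/-- ★ **`SkeletonJ1L` BY NAME from ONE exact streamline with a first-coordinate floor** — `skeletonJ1L_of_halfTurnStreamline` with the two-strand
separation clause replaced by `ρ√Γ/2 ≤ (X₀ τ)₀` for all `τ`. [folklore] -/
theorem skeletonJ1L_of_halfTurnStreamline_coordFloor
    (hfam : ∃ (δ ρ K Λ Rw θ₀ Rb₁ : ℝ), 0 < δ ∧ 0 < ρ ∧ 0 < Rw ∧ 0 < θ₀ ∧ 0 < Rb₁ ∧ Rb₁ ≤ 1 / 2 ∧ 2 * K * ρ ≤ 1 ∧ 1 ≤ Λ ∧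
      (θ₀ ≤ |(875/432 : ℝ)| ∧ |(875/432 : ℝ)| ≤ θ₀⁻¹ ∧ θ₀ ≤ |(125 * Real.pi / 108 : ℝ)| ∧ |(125 * Real.pi / 108 : ℝ)| ≤ θ₀⁻¹) ∧
      ∀ Rb : ℝ, 0 < Rb → Rb ≤ Rb₁ → ∃ Γ₂ : ℝ, ∀ Γ : ℝ, Γ₂ ≤ Γ →
        ∃ (X : Fin 2 → ℝ → EuclideanSpace ℝ (Fin 3)) (w₀ : ℝ → ℝ) (cc : ℝ),
          (∀ σ, X 1 σ 0 = -X 0 σ 0 ∧ X 1 σ 1 = -X 0 σ 1 ∧ X 1 σ 2 = X 0 σ 2) ∧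
          ContDiff ℝ 2 (X 0) ∧ (∀ τ, ‖deriv (X 0) τ‖ = 1) ∧ (∀ τ, ‖iteratedDeriv 2 (X 0) τ‖*√Γ≤K) ∧
          (∀ τ σ, ‖deriv (X 0) τ - deriv (X 0) σ‖ ≤ Rb) ∧
          (∀ τ, ρ * √Γ / 2 ≤ X 0 τ 0) ∧ ‖X 0 cc‖≤Rw*√Γ ∧ |⟪deriv (X 0) cc, EuclideanSpace.single 2 1⟫_ℝ|≤1-θ₀ ∧
          (∀ τ, w₀ τ = ⟪trueField Γ (fun _ : Fin 2 => 125 * Real.pi / 108) (875/432 : ℝ) X (X 0 τ), deriv (X 0) τ⟫_ℝ) ∧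
          Differentiable ℝ w₀ ∧ (w₀ cc = 0 ∧ (∀ τ, w₀ τ = 0 → τ = cc) ∧ 3/2+δ≤deriv w₀ cc ∧ deriv w₀ cc≤Λ) ∧ (∀ τ, |deriv w₀ τ| ≤ Λ) ∧
          (∀ τ, ‖X 0 τ‖≤Rb*√(Γ*Real.log Γ) →
            trueField Γ (fun _ : Fin 2 => 125 * Real.pi / 108) (875/432 : ℝ) X (X 0 τ) = w₀ τ•deriv (X 0) τ))
    (h3 : Summit.NavierStokesRegularity.NavierStokesRegularity.Theses.FilamentSkeletonRss.Clause13NearStraightL) :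
    Summit.NavierStokesRegularity.NavierStokesRegularity.Theses.FilamentSkeletonRss.SkeletonJ1L := by
  obtain ⟨δ, ρ, K, Λ, Rw, θ₀, Rb₁, hδ, hρ, hRw, hθ₀, hRb₁, hRbh, hKρ, hΛ, hbox, hfam⟩ := hfam
  refine skeletonJ1L_of_halfTurnStreamline ⟨δ, ρ, K, Λ, Rw, θ₀, Rb₁, hδ, hρ, hRw, hθ₀, hRb₁, hRbh, hKρ, hΛ, hbox, ?_⟩ h3
  intro Rb hRb hRb1
  obtain ⟨Γ₂, hΓ⟩ := hfam Rb hRb hRb1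
  refine ⟨Γ₂, fun Γ hΓ2 => ?_⟩
  obtain ⟨X, w₀, cc, hsym, hC, hunit, hcurv, hosc, hfloor, hwaist, htilt, hslip, hwd, hzero, hw', htan⟩ := hΓ Γ hΓ2
  refine ⟨X, w₀, cc, hsym, hC, hunit, hcurv, hosc, fun τ σ => ?_, hwaist, htilt, hslip, hwd, hzero, hw', htan⟩
  have hΓ0 : 0 ≤ ρ * √Γ / 2 := by positivity
  have := sep_of_coordFloor hsym hΓ0 hfloor τ σ
  linarith

end Summit.NavierStokesRegularity.NavierStokesRegularity.Theorems.SkeletonJ1LSymmetricStreamline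

end
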